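import Mathlib
import Summits.CriticalPhenomena.SAWScalingLimit.Theorems.SAWRestrictionRigidityAxiomsOfLimitMarkovRationalLeftLimits
import HarnessLib

/-!
# Conditional expectations on announcing events (soft-Markov brick SM5a)

Crux `AxiomsOfLimit` (stmt-CriticalPhenomena-1370), line `registered`, stub `stub_markovOfLimit`,
soft-Markov brick SM5a "identification of the conditional expectation given the strict past with
the martingale left limit on announcing events" (lead c4). Theorems only.

Setting: a finite measure `μ`, an `ℝ`-indexed filtration `ℱ`, a function `ξ`, and an increasing,
uniformly bounded sequence of stopping times `σ n` taking rational values. On an event `B` the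
`σ n` are `< τ` and converge to `τ` (they *announce* `τ` on `B`), and on `B` the σ-algebra
`⨆ n, ℱ_{σ n}` has the same trace as a σ-algebra `ℋ`, with `B` in both. Conclusion
(`stub_condExpOnAnnouncingEvent`, via the `Type*`-general `ae_tendsto_condExp_of_announcing`):
for almost every `ω ∈ B`, the rational martingale `q ↦ μ[ξ | ℱ q] ω` converges, as `q ↑ τ ω`
along rationals, to `μ[ξ | ℋ] ω`.

Route:
* left limits of the rational martingale at every real point, almost surely
  (`ae_forall_exists_tendsto_condExp_ratCast`, brick SM2');
* optional sampling at the countable-range bounded stopping times `σ n`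
  (`condExp_stoppingTime_ae_eq_of_countable_range`): `μ[ξ | ℱ_{σ n}] ω = μ[ξ | ℱ (σ n ω)] ω`;
* Lévy's upward theorem along `n ↦ ℱ_{σ n}` (`MeasureTheory.tendsto_ae_condExp`);
* locality of conditional expectations on the event `B` where the two σ-algebras have the same
  trace (`MeasureTheory.condExp_ae_eq_restrict_of_measurableSpace_eq_on`);
* uniqueness of limits along the announcing sequence.

Folklore: C. Dellacherie, P.-A. Meyer, Probabilités et potentiel, Ch. IV–VI (predictable
projection at announceable times), here for announcers with countable range. All `[folklore]`.
-/

noncomputable section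

open MeasureTheory Filter Topology Set

namespace Summit.CriticalPhenomena.SAWScalingLimit.Theorems.AxiomsOfLimitMarkov

/-- Optional sampling for the martingale `t ↦ μ[ξ | ℱ t]` at a bounded real stopping time `ρ`
with countable range: almost surely `μ[ξ | ℱ_ρ] ω = μ[ξ | ℱ (ρ ω)] ω`. [folklore] -/
theorem condExp_stoppingTime_ae_eq_of_countable_range {Ω : Type*} {mΩ : MeasurableSpace Ω}
    (μ : Measure Ω) [IsFiniteMeasure μ] (ℱ : Filtration ℝ mΩ) (ξ : Ω → ℝ) (ρ : Ω → ℝ)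
    (hρ : IsStoppingTime ℱ (fun ω => ((ρ ω : ℝ) : WithTop ℝ)))
    (hcount : (Set.range ρ).Countable) {T : ℝ} (hT : ∀ ω, ρ ω ≤ T) :
    ∀ᵐ ω ∂μ, μ[ξ|hρ.measurableSpace] ω = μ[ξ|ℱ (ρ ω)] ω := by
  have hmart : Martingale (fun t => μ[ξ|ℱ t]) ℱ μ := martingale_condExp ξ ℱ μ
  have hle : ∀ ω, (fun ω => ((ρ ω : ℝ) : WithTop ℝ)) ω ≤ (T : WithTop ℝ) :=
    fun ω => WithTop.coe_le_coe.2 (hT ω)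
  have hcount' : (Set.range fun ω => ((ρ ω : ℝ) : WithTop ℝ)).Countable := by
    rw [show (fun ω => ((ρ ω : ℝ) : WithTop ℝ)) = (fun r : ℝ => (r : WithTop ℝ)) ∘ ρ from rfl,
      Set.range_comp]
    exact hcount.image _
  have h1 := hmart.stoppedValue_ae_eq_condExp_of_le_const_of_countable_range hρ hle hcount'
  have h2 : μ[μ[ξ|ℱ T]|hρ.measurableSpace] =ᵐ[μ] μ[ξ|hρ.measurableSpace] :=
    condExp_condExp_of_le (hρ.measurableSpace_le_of_le_const hle) (ℱ.le T)
  filter_upwards [h1, h2] with ω h1 h2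
  calc μ[ξ|hρ.measurableSpace] ω = μ[μ[ξ|ℱ T]|hρ.measurableSpace] ω := h2.symm
    _ = stoppedValue (fun t => μ[ξ|ℱ t]) (fun ω => ((ρ ω : ℝ) : WithTop ℝ)) ω := h1.symm
    _ = μ[ξ|ℱ (ρ ω)] ω := rfl

/-- **Conditional expectations on announcing events.** Let `σ n` be an increasing, uniformly
bounded sequence of rational-valued stopping times of an `ℝ`-indexed filtration `ℱ`, announcing
`τ` on the event `B` (`σ n < τ`, `σ n → τ` on `B`), and let `ℋ` be a σ-algebra with the same trace
on `B` as `⨆ n, ℱ_{σ n}`, `B` belonging to both. Then for almost every `ω ∈ B` the rational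
martingale `q ↦ μ[ξ | ℱ q] ω` tends to `μ[ξ | ℋ] ω` as `q ↑ τ ω` along rationals. [folklore] -/
theorem ae_tendsto_condExp_of_announcing {Ω : Type*} {mΩ : MeasurableSpace Ω} (μ : Measure Ω)
    [IsFiniteMeasure μ] (ℱ : Filtration ℝ mΩ) (ξ : Ω → ℝ) (σ : ℕ → Ω → ℝ)
    (hσ : ∀ n, IsStoppingTime ℱ (fun ω => ((σ n ω : ℝ) : WithTop ℝ)))
    (hrat : ∀ n ω, σ n ω ∈ Set.range (fun q : ℚ => (q : ℝ)))
    (hmono : ∀ n ω, σ n ω ≤ σ (n + 1) ω) (hbdd : ∃ T : ℝ, ∀ n ω, σ n ω ≤ T)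
    (τ : Ω → ℝ) (B : Set Ω) (hlt : ∀ ω ∈ B, ∀ n, σ n ω < τ ω)
    (hlim : ∀ ω ∈ B, Tendsto (fun n => σ n ω) atTop (𝓝 (τ ω)))
    (ℋ : MeasurableSpace Ω) (hℋ : ℋ ≤ mΩ) (hBℋ : MeasurableSet[ℋ] B)
    (hB : MeasurableSet[⨆ n, (hσ n).measurableSpace] B)
    (hloc : ∀ t : Set Ω, MeasurableSet[⨆ n, (hσ n).measurableSpace] (B ∩ t) ↔
      MeasurableSet[ℋ] (B ∩ t)) :
    ∀ᵐ ω ∂μ, ω ∈ B → Tendsto (fun q : ℚ => μ[ξ|ℱ (q : ℝ)] ω)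
      (comap (fun q : ℚ => (q : ℝ)) (𝓝[<] (τ ω))) (𝓝 (μ[ξ|ℋ] ω)) := by
  -- (1) left limits of the rational martingale at every real point
  let ℱℚ : Filtration ℚ mΩ :=
    ⟨fun q => ℱ (q : ℝ), fun _ _ h => ℱ.mono (Rat.cast_le.2 h), fun q => ℱ.le _⟩
  have h1 : ∀ᵐ ω ∂μ, ∀ u : ℝ, ∃ L : ℝ, Tendsto (fun q : ℚ => μ[ξ|ℱ (q : ℝ)] ω)
      (comap (fun q : ℚ => (q : ℝ)) (𝓝[<] u)) (𝓝 L) :=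
    ae_forall_exists_tendsto_condExp_ratCast μ ℱℚ ξ
  -- (2) Lévy's upward theorem along the stopped σ-algebras
  let 𝒢 : Filtration ℕ mΩ :=
    ⟨fun n => (hσ n).measurableSpace, monotone_nat_of_le_succ fun n =>
      (hσ n).measurableSpace_mono (hσ (n + 1)) fun ω => WithTop.coe_le_coe.2 (hmono n ω),
      fun n => (hσ n).measurableSpace_le⟩
  have h2 : ∀ᵐ ω ∂μ, Tendsto (fun n => μ[ξ|(hσ n).measurableSpace] ω) atTop
      (𝓝 (μ[ξ|⨆ n, (hσ n).measurableSpace] ω)) :=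
    tendsto_ae_condExp (ℱ := 𝒢) ξ
  -- (3) optional sampling at the countable-range stopping times `σ n`
  have h3 : ∀ᵐ ω ∂μ, ∀ n, μ[ξ|(hσ n).measurableSpace] ω = μ[ξ|ℱ (σ n ω)] ω := by
    obtain ⟨T, hT⟩ := hbdd
    refine ae_all_iff.2 fun n => condExp_stoppingTime_ae_eq_of_countable_range μ ℱ ξ (σ n)
      (hσ n) ((Set.countable_range (fun q : ℚ => (q : ℝ))).mono ?_) (hT n)
    rintro _ ⟨ω, rfl⟩
    exact hrat n ω
  -- (4) locality of conditional expectations on `B`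
  have h4 : ∀ᵐ ω ∂μ, ω ∈ B → μ[ξ|⨆ n, (hσ n).measurableSpace] ω = μ[ξ|ℋ] ω :=
    (ae_restrict_iff' (hℋ B hBℋ)).1 (condExp_ae_eq_restrict_of_measurableSpace_eq_on (f := ξ)
      (iSup_le fun n => (hσ n).measurableSpace_le) hℋ hB hloc)
  -- (5) combine along the announcing sequence
  filter_upwards [h1, h2, h3, h4] with ω h1 h2 h3 h4 hωB
  obtain ⟨L, hL⟩ := h1 (τ ω)
  have hq : ∀ n, ∃ r : ℚ, (r : ℝ) = σ n ω := fun n => Set.mem_range.1 (hrat n ω)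
  choose q hq using hq
  have hqt : Tendsto q atTop (comap (fun q : ℚ => (q : ℝ)) (𝓝[<] (τ ω))) := by
    rw [tendsto_comap_iff, show (fun q : ℚ => (q : ℝ)) ∘ q = fun n => σ n ω from funext hq]
    exact tendsto_nhdsWithin_iff.2 ⟨hlim ω hωB, Eventually.of_forall fun n => hlt ω hωB n⟩
  have hA : Tendsto (fun n => μ[ξ|ℱ (q n : ℝ)] ω) atTop (𝓝 L) := hL.comp hqt
  have hB' : Tendsto (fun n => μ[ξ|ℱ (q n : ℝ)] ω) atTop (𝓝 (μ[ξ|ℋ] ω)) := by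
    rw [show (fun n => μ[ξ|ℱ (q n : ℝ)] ω) = fun n => μ[ξ|(hσ n).measurableSpace] ω from
      funext fun n => by rw [hq n, h3 n], ← h4 hωB]
    exact h2
  rwa [tendsto_nhds_unique hA hB'] at hL

/-- Registered stub `stub_condExpOnAnnouncingEvent` of crux `AxiomsOfLimit`
(stmt-CriticalPhenomena-1370), line `registered`: on an event `B` where rational-valued,
increasing, uniformly bounded stopping times `σ n` announce `τ` and where `⨆ n, ℱ_{σ n}` and `ℋ`
have the same trace, for almost every `ω ∈ B` the rational martingale `q ↦ μ[ξ | ℱ q] ω`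
converges as `q ↑ τ ω` to `μ[ξ | ℋ] ω` (the integrability hypothesis is not needed). [folklore] -/
theorem stub_condExpOnAnnouncingEvent : ∀ (Ω : Type) [mΩ : MeasurableSpace Ω] (μ : MeasureTheory.Measure Ω) [MeasureTheory.IsFiniteMeasure μ] (ℱ : MeasureTheory.Filtration ℝ mΩ) (ξ : Ω → ℝ), MeasureTheory.Integrable ξ μ → ∀ (σ : ℕ → Ω → ℝ) (hσ : ∀ n, MeasureTheory.IsStoppingTime ℱ (fun ω => ((σ n ω : ℝ) : WithTop ℝ))), (∀ n ω, σ n ω ∈ Set.range (fun q : ℚ => (q : ℝ))) → (∀ n ω, σ n ω ≤ σ (n + 1) ω) → (∃ T : ℝ, ∀ n ω, σ n ω ≤ T) → ∀ (τ : Ω → ℝ) (B : Set Ω), (∀ ω ∈ B, ∀ n, σ n ω < τ ω) → (∀ ω ∈ B, Filter.Tendsto (fun n => σ n ω) Filter.atTop (nhds (τ ω))) → ∀ (ℋ : MeasurableSpace Ω), ℋ ≤ mΩ → @MeasurableSet Ω ℋ B → @MeasurableSet Ω (⨆ n, (hσ n).measurableSpace) B → (∀ t : Set Ω, @MeasurableSet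 Ω (⨆ n, (hσ n).measurableSpace) (B ∩ t) ↔ @MeasurableSet Ω ℋ (B ∩ t)) → Filter.Eventually (fun ω => ω ∈ B → Filter.Tendsto (fun q : ℚ => MeasureTheory.condExp (ℱ (q : ℝ)) μ ξ ω) (Filter.comap (fun q : ℚ => (q : ℝ)) (nhdsWithin (τ ω) (Set.Iio (τ ω)))) (nhds (MeasureTheory.condExp ℋ μ ξ ω))) (MeasureTheory.ae μ) :=
  fun _ _ μ _ ℱ ξ _ σ hσ hrat hmono hbdd τ B hlt hlim ℋ hℋ hBℋ hB hloc =>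
    ae_tendsto_condExp_of_announcing μ ℱ ξ σ hσ hrat hmono hbdd τ B hlt hlim ℋ hℋ hBℋ hB hloc

end Summit.CriticalPhenomena.SAWScalingLimit.Theorems.AxiomsOfLimitMarkov

end
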